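import Summits.CriticalPhenomena.PercolationContinuityZ3.Theorems.PercNearOneGluingNoHeavyLowerTailCILPortDomination
import Literature.Probability.LatticeModels.ProdBernoulliClusterLocality
import HarnessLib

/-!
# `NoHeavyLowerTail` (stmt-CriticalPhenomena-4575) — merging an observer SET into one observer vertex
# (transport of the tree's single-observer port theorems to relay-neighboured Steiner sets)

Support file (prover `prim-hp-6`, hull-port cell, observer-set / OES technique; `--supports stmt-CriticalPhenomena-4575`).
No definitions, no named facts, no sorries.

Notation: `μ_w = prodBernoulli w` on `Fin n`, `U` a finite vertex set (the observer set), `u₁ ∈ U` its anchor.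
Two configurations `ω, ω'` AGREE MODULO `U` if they have the same edges off `U` and, for every vertex `v ∉ U`, `v` receives
an open edge from `U` in `ω` iff it does in `ω'`.  An event is `U`-STABLE if it does not separate agreeing configurations.
The set events of the crux line — `{1 ≤ |π(U)| ≤ j}`, `{c ↮ U, …}`, the glued lightness events — are `U`-stable
(`uStable_…` below: whether a vertex is joined to SOME member of `U`, and the cluster of a vertex NOT joined to `U`, are read
off the agreement data, by the exit decomposition `exists_exit_of_reachable`).

* `SetPort.orMerge_real_eq` — **OR-merge of two pairs.**  If an event depends on the pairs `e₁ ≠ e₂` only through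
  "`e₁` open or `e₂` open", its probability is unchanged when the weight of `e₂` is moved onto `e₁`:
  `w ↦ w[e₂ ↦ 0][e₁ ↦ 1 − (1 − w e₁)(1 − w e₂)]` (four-corner decomposition + independence of disjoint supports).
* `SetPort.uStable_events` — the set events above are `U`-stable.
The member merge itself (`μ_w(E) = μ_{w♯}(E)` for the merged weights `w♯`) is `…SetPortMergeWeights.lean`, and the
consequences for set-champion stability (transport of `Theorems.cil_relayNeighbours_port`, `cil_of_portDomination`) are
drawn in `…SetPortDomination.lean`.
-/

noncomputable section

namespace Summit.CriticalPhenomena.PercolationContinuityZ3.Theorems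

open MeasureTheory Set Literature.Probability.LatticeModels Literature.Probability.Percolation
open scoped Classical BigOperators

variable {n : ℕ}

namespace SetPort

/-! ### OR-merge of two pairs -/

/-- The merged coin weight `1 − (1 − a)(1 − b)` as a point of the unit interval. [folklore] -/
theorem orWeight_mem (a b : unitInterval) : (1 - (1 - (a : ℝ)) * (1 - (b : ℝ))) ∈ unitInterval := by
  have ha0 := a.2.1; have ha1 := a.2.2; have hb0 := b.2.1; have hb1 := b.2.2
  constructor <;> nlinarith [mul_nonneg (sub_nonneg.2 ha1) (sub_nonneg.2 hb1)]

/-- **OR-merge of two pairs.**  Let `e₁ ≠ e₂` and let the event `E` depend on `e₁, e₂` only through "`e₁ ∈ ω ∨ e₂ ∈ ω`":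
the three configurations `insert e₁ (ω ∖ {e₂})`, `insert e₂ (ω ∖ {e₁})`, `insert e₁ (insert e₂ ω)` lie in `E` together.
Then for any `m` with `m = 1 − (1 − w e₁)(1 − w e₂)`:  `μ_w(E) = μ_{w[e₂ ↦ 0][e₁ ↦ m]}(E)`. [folklore] -/
theorem orMerge_real_eq (w : Sym2 (Fin n) → unitInterval) {e₁ e₂ : Sym2 (Fin n)} (h12 : e₁ ≠ e₂)
    (E : Set (BondConfig (Fin n)))
    (hswap : ∀ ω : BondConfig (Fin n), insert e₂ (ω \ {e₁}) ∈ E ↔ insert e₁ (ω \ {e₂}) ∈ E)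
    (hboth : ∀ ω : BondConfig (Fin n), insert e₁ (insert e₂ ω) ∈ E ↔ insert e₁ (ω \ {e₂}) ∈ E)
    (m : unitInterval) (hm : (m : ℝ) = 1 - (1 - (w e₁ : ℝ)) * (1 - (w e₂ : ℝ))) :
    (prodBernoulli w).real E =
      (prodBernoulli (Function.update (Function.update w e₂ 0) e₁ m)).real E := by
  -- the two auxiliary events, determined by the pairs other than `e₁, e₂`
  set F : Finset (Sym2 (Fin n)) := {e₁, e₂} with hF
  set E₁ : Set (BondConfig (Fin n)) := {ω | insert e₁ (ω \ {e₂}) ∈ E} with hE₁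
  set E₀ : Set (BondConfig (Fin n)) := {ω | (ω \ {e₁}) \ {e₂} ∈ E} with hE₀
  set C : Set (BondConfig (Fin n)) := {ω | ∀ i ∈ F, i ∉ ω} with hC
  have hdet1 : DeterminedBy E₁ (↑F : Set (Sym2 (Fin n)))ᶜ := by
    rw [determinedBy_iff]
    intro ω ω' h
    have key : insert e₁ (ω \ {e₂}) = insert e₁ (ω' \ {e₂}) := by
      ext x
      by_cases hx1 : x = e₁
      · subst hx1; simp
      by_cases hx2 : x = e₂
      · subst hx2; simp [Ne.symm h12]
      have hxF : x ∈ (↑F : Set (Sym2 (Fin n)))ᶜ := by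
        simp only [hF, Finset.coe_insert, Finset.coe_singleton, mem_compl_iff, mem_insert_iff,
          mem_singleton_iff, not_or]; exact ⟨hx1, hx2⟩
      have := Set.ext_iff.1 h x
      simp only [mem_inter_iff, hxF, and_true] at this
      simp only [mem_insert_iff, hx1, false_or, mem_sdiff, mem_singleton_iff, hx2, not_false_eq_true, and_true]
      exact this
    simp only [hE₁, mem_setOf_eq, key]
  have hdet0 : DeterminedBy E₀ (↑F : Set (Sym2 (Fin n)))ᶜ := by
    rw [determinedBy_iff]
    intro ω ω' h
    have key : (ω \ {e₁}) \ {e₂} = (ω' \ {e₁}) \ {e₂} := by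
      ext x
      by_cases hx1 : x = e₁
      · subst hx1; simp
      by_cases hx2 : x = e₂
      · subst hx2; simp
      have hxF : x ∈ (↑F : Set (Sym2 (Fin n)))ᶜ := by
        simp only [hF, Finset.coe_insert, Finset.coe_singleton, mem_compl_iff, mem_insert_iff,
          mem_singleton_iff, not_or]; exact ⟨hx1, hx2⟩
      have := Set.ext_iff.1 h x
      simp only [mem_inter_iff, hxF, and_true] at this
      simp only [mem_sdiff, mem_singleton_iff, hx1, not_false_eq_true, and_true, hx2]
      exact this
    simp only [hE₀, mem_setOf_eq, key]
  have hdetC : DeterminedBy C (↑F : Set (Sym2 (Fin n))) := by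
    rw [determinedBy_iff]
    intro ω ω' h
    simp only [hC, mem_setOf_eq]
    refine forall₂_congr fun i hi => ?_
    have := Set.ext_iff.1 h i
    simp only [mem_inter_iff, Finset.mem_coe, hi, and_true] at this
    exact not_congr this
  -- pointwise: on `Cᶜ` the event is `E₁`, on `C` it is `E₀`
  have hsplit : ∀ ω : BondConfig (Fin n), ω ∈ E ↔ (ω ∈ E₁ ∧ ω ∉ C) ∨ (ω ∈ E₀ ∧ ω ∈ C) := by
    intro ω
    by_cases h1 : e₁ ∈ ω
    · have hnC : ω ∉ C := fun hc => hc e₁ (by simp [hF]) h1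
      by_cases h2 : e₂ ∈ ω
      · have hω : insert e₁ (insert e₂ ω) = ω := by
          rw [Set.insert_eq_of_mem (Set.mem_insert_of_mem _ h1)]; exact Set.insert_eq_of_mem h2
        constructor
        · intro hE; left; refine ⟨?_, hnC⟩
          show insert e₁ (ω \ {e₂}) ∈ E
          rw [← hboth ω, hω]; exact hE
        · rintro (⟨hE1, -⟩ | ⟨-, hc⟩)
          · rw [← hω, hboth ω]; exact hE1
          · exact absurd hc hnC
      · have hω : insert e₁ (ω \ {e₂}) = ω := by
          rw [Set.sdiff_singleton_eq_self h2]; exact Set.insert_eq_of_mem h1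
        constructor
        · intro hE; left; exact ⟨show insert e₁ (ω \ {e₂}) ∈ E by rw [hω]; exact hE, hnC⟩
        · rintro (⟨hE1, -⟩ | ⟨-, hc⟩)
          · have : insert e₁ (ω \ {e₂}) ∈ E := hE1
            rwa [hω] at this
          · exact absurd hc hnC
    · by_cases h2 : e₂ ∈ ω
      · have hnC : ω ∉ C := fun hc => hc e₂ (by simp [hF]) h2
        have hω : insert e₂ (ω \ {e₁}) = ω := by
          rw [Set.sdiff_singleton_eq_self h1]; exact Set.insert_eq_of_mem h2
        constructor
        · intro hE; left; refine ⟨?_, hnC⟩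
          show insert e₁ (ω \ {e₂}) ∈ E
          rw [← hswap ω, hω]; exact hE
        · rintro (⟨hE1, -⟩ | ⟨-, hc⟩)
          · rw [← hω, hswap ω]; exact hE1
          · exact absurd hc hnC
      · have hc : ω ∈ C := by
          intro i hi
          simp only [hF, Finset.mem_insert, Finset.mem_singleton] at hi
          rcases hi with rfl | rfl
          · exact h1
          · exact h2
        have hω : (ω \ {e₁}) \ {e₂} = ω := by
          rw [Set.sdiff_singleton_eq_self h1, Set.sdiff_singleton_eq_self h2]
        constructor
        · intro hE; right; exact ⟨show (ω \ {e₁}) \ {e₂} ∈ E by rw [hω]; exact hE, hc⟩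
        · rintro (⟨-, hnc⟩ | ⟨hE0, -⟩)
          · exact absurd hc hnc
          · have : (ω \ {e₁}) \ {e₂} ∈ E := hE0
            rwa [hω] at this
  have hEeq : E = (E₁ \ C) ∪ (E₀ ∩ C) := by
    ext ω; rw [hsplit ω]; simp only [mem_union, mem_sdiff, mem_inter_iff]
  -- the probability of `E` under any weights `v`, in terms of `E₁, E₀` and the two coins
  have key : ∀ v : Sym2 (Fin n) → unitInterval, (prodBernoulli v).real E =
      (prodBernoulli v).real E₁ * (1 - (1 - (v e₁ : ℝ)) * (1 - (v e₂ : ℝ))) +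
        (prodBernoulli v).real E₀ * ((1 - (v e₁ : ℝ)) * (1 - (v e₂ : ℝ))) := by
    intro v
    have hCv : (prodBernoulli v).real C = (1 - (v e₁ : ℝ)) * (1 - (v e₂ : ℝ)) := by
      rw [hC, prodBernoulli_real_forall_notMem v F, hF, Finset.prod_pair h12]
    have hdisj : Disjoint (E₁ \ C) (E₀ ∩ C) := by
      rw [Set.disjoint_left]; rintro ω ⟨-, hnc⟩ ⟨-, hc⟩; exact hnc hc
    have h1 : (prodBernoulli v).real (E₁ \ C) = (prodBernoulli v).real E₁ - (prodBernoulli v).real (C ∩ E₁) := by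
      rw [inter_comm, ← measureReal_sdiff_add_inter (s := E₁) (t := C) (Set.toFinite _).measurableSet]; ring
    have hind1 : (prodBernoulli v).real (C ∩ E₁) = (prodBernoulli v).real C * (prodBernoulli v).real E₁ :=
      prodBernoulli_real_inter_of_determinedBy v F hdetC hdet1 (Set.toFinite _).measurableSet
        (Set.toFinite _).measurableSet
    have hind0 : (prodBernoulli v).real (C ∩ E₀) = (prodBernoulli v).real C * (prodBernoulli v).real E₀ :=
      prodBernoulli_real_inter_of_determinedBy v F hdetC hdet0 (Set.toFinite _).measurableSet
        (Set.toFinite _).measurableSet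
    rw [hEeq, measureReal_union hdisj (Set.toFinite _).measurableSet, h1, hind1, inter_comm, hind0, hCv]
    ring
  -- compare the two weight functions
  set w' := Function.update (Function.update w e₂ 0) e₁ m with hw'
  have hw'1 : w' e₁ = m := by simp [hw']
  have hw'2 : w' e₂ = 0 := by simp [hw', Function.update_of_ne (Ne.symm h12)]
  have hoff : ∀ i ∈ (↑F : Set (Sym2 (Fin n)))ᶜ, w i = w' i := by
    intro i hi
    simp only [hF, Finset.coe_insert, Finset.coe_singleton, mem_compl_iff, mem_insert_iff, mem_singleton_iff,
      not_or] at hi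
    simp [hw', Function.update_of_ne hi.1, Function.update_of_ne hi.2]
  have hE1eq : (prodBernoulli w).real E₁ = (prodBernoulli w').real E₁ :=
    prodBernoulli_real_eq_of_determinedBy w w' hoff hdet1 (Set.toFinite _).measurableSet
  have hE0eq : (prodBernoulli w).real E₀ = (prodBernoulli w').real E₀ :=
    prodBernoulli_real_eq_of_determinedBy w w' hoff hdet0 (Set.toFinite _).measurableSet
  rw [key w, key w', ← hE1eq, ← hE0eq, hw'1, hw'2, hm]
  push_cast
  ring

/-! ### Agreement modulo an observer set, and stability of events -/

/-- **Exit decomposition.**  If a member of `U` is joined to a vertex `z ∉ U`, then some member `x'` has an OPEN pair to a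
vertex `v ∉ U` which is joined to `z` by an open path using no pair at `U` (cut the path at its last visit to `U`).
[folklore] -/
theorem exists_exit_of_reachable (U : Finset (Fin n)) {ω : BondConfig (Fin n)} {x z : Fin n} (hx : x ∈ U)
    (hz : z ∉ U) (h : (openGraph ω).Reachable x z) :
    ∃ x' ∈ U, ∃ v : Fin n, v ∉ U ∧ s(x', v) ∈ ω ∧
      (openGraph (ω ∩ {e | ∀ u ∈ U, u ∉ e})).Reachable v z := by
  -- induction on a walk from `z` back to `x`
  have key : ∀ (b a : Fin n) (q : (openGraph ω).Walk a b), b ∈ U → a ∉ U →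
      ∃ x' ∈ U, ∃ v : Fin n, v ∉ U ∧ s(x', v) ∈ ω ∧ (openGraph (ω ∩ {e | ∀ u ∈ U, u ∉ e})).Reachable v a := by
    intro b a q
    induction q with
    | nil => intro hb ha; exact absurd hb ha
    | @cons a y b' hadj q' ih =>
      intro hb ha
      rw [openGraph, SimpleGraph.fromEdgeSet_adj] at hadj
      by_cases hy : y ∈ U
      · refine ⟨y, hy, a, ha, ?_, SimpleGraph.Reachable.refl _⟩
        rw [Sym2.eq_swap]; exact hadj.1
      · obtain ⟨x', hx', v, hv, hxv, hreach⟩ := ih hb hy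
        refine ⟨x', hx', v, hv, hxv, hreach.trans ?_⟩
        have hadj' : (openGraph (ω ∩ {e | ∀ u ∈ U, u ∉ e})).Adj y a := by
          rw [openGraph, SimpleGraph.fromEdgeSet_adj]
          refine ⟨⟨?_, ?_⟩, Ne.symm hadj.2⟩
          · rw [Sym2.eq_swap]; exact hadj.1
          · intro u hu hmem
            rcases Sym2.mem_iff.1 hmem with rfl | rfl
            · exact hy hu
            · exact ha hu
        exact hadj'.reachable
  obtain ⟨p⟩ := h
  exact key x z p.reverse hx hz

/-- Converse of the exit decomposition. [folklore] -/
theorem reachable_of_exit (U : Finset (Fin n)) {ω : BondConfig (Fin n)} {x' v z : Fin n} (hx' : x' ∈ U)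
    (hv : v ∉ U) (hxv : s(x', v) ∈ ω) (hreach : (openGraph (ω ∩ {e | ∀ u ∈ U, u ∉ e})).Reachable v z) :
    (openGraph ω).Reachable x' z := by
  have hne : x' ≠ v := fun h => hv (h ▸ hx')
  have hadj : (openGraph ω).Adj x' v := by
    rw [openGraph, SimpleGraph.fromEdgeSet_adj]; exact ⟨hxv, hne⟩
  exact hadj.reachable.trans (CutObserver.reachable_mono inter_subset_left hreach)

/-- Whether SOME member of `U` is joined to `z ∉ U` is read off the agreement data. [folklore] -/
theorem exists_openConn_iff_of_agree (U : Finset (Fin n)) {ω ω' : BondConfig (Fin n)}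
    (h : ((∀ e : Sym2 (Fin n), (∀ u ∈ U, u ∉ e) → (e ∈ ω ↔ e ∈ ω')) ∧
        (∀ v : Fin n, v ∉ U → ((∃ x ∈ U, s(x, v) ∈ ω) ↔ (∃ x ∈ U, s(x, v) ∈ ω')))))
    {z : Fin n} (hz : z ∉ U) :
    (∃ x ∈ U, ω ∈ openConn x z) ↔ (∃ x ∈ U, ω' ∈ openConn x z) := by
  have hoff : ω ∩ {e | ∀ u ∈ U, u ∉ e} = ω' ∩ {e | ∀ u ∈ U, u ∉ e} := by
    ext e
    simp only [mem_inter_iff, mem_setOf_eq]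
    constructor
    · rintro ⟨he, hU⟩; exact ⟨(h.1 e hU).1 he, hU⟩
    · rintro ⟨he, hU⟩; exact ⟨(h.1 e hU).2 he, hU⟩
  constructor
  · rintro ⟨x, hx, hxz⟩
    obtain ⟨x', hx', v, hv, hxv, hreach⟩ := exists_exit_of_reachable U hx hz hxz
    obtain ⟨y, hy, hyv⟩ := (h.2 v hv).1 ⟨x', hx', hxv⟩
    rw [hoff] at hreach
    exact ⟨y, hy, reachable_of_exit U hy hv hyv hreach⟩
  · rintro ⟨x, hx, hxz⟩
    obtain ⟨x', hx', v, hv, hxv, hreach⟩ := exists_exit_of_reachable U hx hz hxz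
    obtain ⟨y, hy, hyv⟩ := (h.2 v hv).2 ⟨x', hx', hxv⟩
    rw [← hoff] at hreach
    exact ⟨y, hy, reachable_of_exit U hy hv hyv hreach⟩

/-- A vertex joined to no member of `U` reaches exactly what it reaches without the pairs at `U`. [folklore] -/
theorem reachable_iff_avoid_of_forall_not (U : Finset (Fin n)) {ω : BondConfig (Fin n)} {c : Fin n}
    (hc : ∀ x ∈ U, ¬ (openGraph ω).Reachable c x) (z : Fin n) :
    (openGraph ω).Reachable c z ↔ (openGraph (ω ∩ {e | ∀ u ∈ U, u ∉ e})).Reachable c z := by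
  have key : ∀ (b a : Fin n) (p : (openGraph ω).Walk a b), (∀ x ∈ U, ¬ (openGraph ω).Reachable a x) →
      (openGraph (ω ∩ {e | ∀ u ∈ U, u ∉ e})).Reachable a b := by
    intro b a p
    induction p with
    | nil => intro; exact SimpleGraph.Reachable.refl _
    | @cons a y b' hadj p' ih =>
      intro ha
      have haU : a ∉ U := fun hmem => ha a hmem (SimpleGraph.Reachable.refl _)
      have hyU : y ∉ U := fun hmem => ha y hmem hadj.reachable
      have hy : ∀ x ∈ U, ¬ (openGraph ω).Reachable y x :=
        fun x hx hyx => ha x hx (hadj.reachable.trans hyx)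
      rw [openGraph, SimpleGraph.fromEdgeSet_adj] at hadj
      have hadj' : (openGraph (ω ∩ {e | ∀ u ∈ U, u ∉ e})).Adj a y := by
        rw [openGraph, SimpleGraph.fromEdgeSet_adj]
        refine ⟨⟨hadj.1, ?_⟩, hadj.2⟩
        intro u hu hmem
        rcases Sym2.mem_iff.1 hmem with rfl | rfl
        · exact haU hu
        · exact hyU hu
      exact hadj'.reachable.trans (ih hy)
  refine ⟨fun h => ?_, fun h => CutObserver.reachable_mono inter_subset_left h⟩
  obtain ⟨p⟩ := h
  exact key z c p hc

/-- For agreeing configurations, a vertex `c ∉ U` is joined to no member in one iff in the other, and then its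
cluster is the same. [folklore] -/
theorem openConn_iff_of_agree_of_forall_not (U : Finset (Fin n)) {ω ω' : BondConfig (Fin n)}
    (h : ((∀ e : Sym2 (Fin n), (∀ u ∈ U, u ∉ e) → (e ∈ ω ↔ e ∈ ω')) ∧
        (∀ v : Fin n, v ∉ U → ((∃ x ∈ U, s(x, v) ∈ ω) ↔ (∃ x ∈ U, s(x, v) ∈ ω')))))
    {c : Fin n} (hcU : c ∉ U) (hc : ∀ x ∈ U, ω ∉ openConn c x) (z : Fin n) :
    (ω ∈ openConn c z ↔ ω' ∈ openConn c z) := by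
  have hoff : ω ∩ {e | ∀ u ∈ U, u ∉ e} = ω' ∩ {e | ∀ u ∈ U, u ∉ e} := by
    ext e
    simp only [mem_inter_iff, mem_setOf_eq]
    constructor
    · rintro ⟨he, hU⟩; exact ⟨(h.1 e hU).1 he, hU⟩
    · rintro ⟨he, hU⟩; exact ⟨(h.1 e hU).2 he, hU⟩
  have hc1 : ∀ x ∈ U, ¬ (openGraph ω).Reachable c x := fun x hx hcx => hc x hx hcx
  have hc' : ∀ x ∈ U, ω' ∉ openConn c x := by
    intro x hx hcx
    have : ∃ y ∈ U, ω' ∈ openConn y c := ⟨x, hx, (show (openGraph ω').Reachable c x from hcx).symm⟩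
    obtain ⟨y, hy, hyc⟩ := (exists_openConn_iff_of_agree U h hcU).2 this
    exact hc y hy (show (openGraph ω).Reachable c y from (show (openGraph ω).Reachable y c from hyc).symm)
  have hc2 : ∀ x ∈ U, ¬ (openGraph ω').Reachable c x := fun x hx hcx => hc' x hx hcx
  show (openGraph ω).Reachable c z ↔ (openGraph ω').Reachable c z
  rw [reachable_iff_avoid_of_forall_not U hc1 z, reachable_iff_avoid_of_forall_not U hc2 z, hoff]

/-- For agreeing configurations the relay sets joined to `U` coincide (`U` disjoint from `A`). [folklore] -/
theorem filter_eq_of_agree (A U : Finset (Fin n)) (hUA : Disjoint U A) {ω ω' : BondConfig (Fin n)}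
    (h : ((∀ e : Sym2 (Fin n), (∀ u ∈ U, u ∉ e) → (e ∈ ω ↔ e ∈ ω')) ∧
      (∀ v : Fin n, v ∉ U → ((∃ x ∈ U, s(x, v) ∈ ω) ↔ (∃ x ∈ U, s(x, v) ∈ ω'))))) :
    (A.filter fun z => ∃ x ∈ U, ω ∈ openConn x z) = (A.filter fun z => ∃ x ∈ U, ω' ∈ openConn x z) := by
  refine Finset.filter_congr fun z hz => ?_
  exact exists_openConn_iff_of_agree U h (fun hzU => Finset.disjoint_left.1 hUA hzU hz)

/-- For agreeing configurations, `c ∉ U` is separated from `U` in one iff in the other. [folklore] -/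
theorem sep_iff_of_agree (U : Finset (Fin n)) {c : Fin n} (hcU : c ∉ U) {ω ω' : BondConfig (Fin n)}
    (h : ((∀ e : Sym2 (Fin n), (∀ u ∈ U, u ∉ e) → (e ∈ ω ↔ e ∈ ω')) ∧
      (∀ v : Fin n, v ∉ U → ((∃ x ∈ U, s(x, v) ∈ ω) ↔ (∃ x ∈ U, s(x, v) ∈ ω'))))) :
    (∀ x ∈ U, ω ∉ openConn c x) ↔ (∀ x ∈ U, ω' ∉ openConn c x) := by
  have e1 : ∀ ξ : BondConfig (Fin n), (∀ x ∈ U, ξ ∉ openConn c x) ↔ ¬ ∃ x ∈ U, ξ ∈ openConn x c := by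
    intro ξ
    constructor
    · rintro hall ⟨x, hx, hxc⟩
      exact hall x hx (show (openGraph ξ).Reachable c x from (show (openGraph ξ).Reachable x c from hxc).symm)
    · intro hno x hx hcx; exact hno ⟨x, hx, (show (openGraph ξ).Reachable c x from hcx).symm⟩
  rw [e1, e1, exists_openConn_iff_of_agree U h hcU]

/-- The bad event `{1 ≤ |π(U)| ≤ j}` of an observer set `U` disjoint from `A` is `U`-stable. [folklore] -/
theorem uStable_bad (A U : Finset (Fin n)) (hUA : Disjoint U A) (j : ℕ) :
    ∀ ξ ξ' : BondConfig (Fin n),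
      ((∀ e : Sym2 (Fin n), (∀ u ∈ U, u ∉ e) → (e ∈ ξ ↔ e ∈ ξ')) ∧
        (∀ v : Fin n, v ∉ U → ((∃ x ∈ U, s(x, v) ∈ ξ) ↔ (∃ x ∈ U, s(x, v) ∈ ξ')))) →
      (ξ ∈ {ω : BondConfig (Fin n) |
          1 ≤ (A.filter fun z => ∃ x ∈ U, ω ∈ openConn x z).card ∧
          (A.filter fun z => ∃ x ∈ U, ω ∈ openConn x z).card ≤ j} ↔
        ξ' ∈ {ω : BondConfig (Fin n) |
          1 ≤ (A.filter fun z => ∃ x ∈ U, ω ∈ openConn x z).card ∧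
          (A.filter fun z => ∃ x ∈ U, ω ∈ openConn x z).card ≤ j}) := by
  intro ξ ξ' h
  simp only [mem_setOf_eq, filter_eq_of_agree A U hUA h]

/-- The separated events `{c ↮ U, 1 ≤ |π(U)| ≤ j}`, `{c ↮ U, |π(c)| ≤ j}` and the glued-lightness event
`{c ↔ U, |π(U)| ≤ j}` are `U`-stable (`U` disjoint from `A`, `c ∉ U`). [folklore] -/
theorem uStable_events (A U : Finset (Fin n)) (hUA : Disjoint U A) (c : Fin n) (hcU : c ∉ U) (j : ℕ) :
    (∀ ξ ξ' : BondConfig (Fin n),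
      ((∀ e : Sym2 (Fin n), (∀ u ∈ U, u ∉ e) → (e ∈ ξ ↔ e ∈ ξ')) ∧
        (∀ v : Fin n, v ∉ U → ((∃ x ∈ U, s(x, v) ∈ ξ) ↔ (∃ x ∈ U, s(x, v) ∈ ξ')))) →
      (ξ ∈ {ω : BondConfig (Fin n) | (∀ x ∈ U, ω ∉ openConn c x) ∧
          1 ≤ (A.filter fun z => ∃ x ∈ U, ω ∈ openConn x z).card ∧
          (A.filter fun z => ∃ x ∈ U, ω ∈ openConn x z).card ≤ j} ↔
        ξ' ∈ {ω : BondConfig (Fin n) | (∀ x ∈ U, ω ∉ openConn c x) ∧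
          1 ≤ (A.filter fun z => ∃ x ∈ U, ω ∈ openConn x z).card ∧
          (A.filter fun z => ∃ x ∈ U, ω ∈ openConn x z).card ≤ j})) ∧
    (∀ ξ ξ' : BondConfig (Fin n),
      ((∀ e : Sym2 (Fin n), (∀ u ∈ U, u ∉ e) → (e ∈ ξ ↔ e ∈ ξ')) ∧
        (∀ v : Fin n, v ∉ U → ((∃ x ∈ U, s(x, v) ∈ ξ) ↔ (∃ x ∈ U, s(x, v) ∈ ξ')))) →
      (ξ ∈ {ω : BondConfig (Fin n) | (∀ x ∈ U, ω ∉ openConn c x) ∧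
          (A.filter fun z => ω ∈ openConn c z).card ≤ j} ↔
        ξ' ∈ {ω : BondConfig (Fin n) | (∀ x ∈ U, ω ∉ openConn c x) ∧
          (A.filter fun z => ω ∈ openConn c z).card ≤ j})) ∧
    (∀ ξ ξ' : BondConfig (Fin n),
      ((∀ e : Sym2 (Fin n), (∀ u ∈ U, u ∉ e) → (e ∈ ξ ↔ e ∈ ξ')) ∧
        (∀ v : Fin n, v ∉ U → ((∃ x ∈ U, s(x, v) ∈ ξ) ↔ (∃ x ∈ U, s(x, v) ∈ ξ')))) →
      (ξ ∈ {ω : BondConfig (Fin n) | (∃ x ∈ U, ω ∈ openConn c x) ∧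
          (A.filter fun z => ∃ x ∈ U, ω ∈ openConn x z).card ≤ j} ↔
        ξ' ∈ {ω : BondConfig (Fin n) | (∃ x ∈ U, ω ∈ openConn c x) ∧
          (A.filter fun z => ∃ x ∈ U, ω ∈ openConn x z).card ≤ j})) := by
  refine ⟨?_, ?_, ?_⟩
  · intro ξ ξ' h
    simp only [mem_setOf_eq, filter_eq_of_agree A U hUA h, sep_iff_of_agree U hcU h]
  · intro ξ ξ' h
    simp only [mem_setOf_eq]
    constructor
    · rintro ⟨hc, hcard⟩
      refine ⟨(sep_iff_of_agree U hcU h).1 hc, ?_⟩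
      have : (A.filter fun z => ξ' ∈ openConn c z) = (A.filter fun z => ξ ∈ openConn c z) :=
        Finset.filter_congr fun z _ => (openConn_iff_of_agree_of_forall_not U h hcU hc z).symm
      rw [this]; exact hcard
    · rintro ⟨hc', hcard⟩
      have hc : ∀ x ∈ U, ξ ∉ openConn c x := (sep_iff_of_agree U hcU h).2 hc'
      refine ⟨hc, ?_⟩
      have : (A.filter fun z => ξ ∈ openConn c z) = (A.filter fun z => ξ' ∈ openConn c z) :=
        Finset.filter_congr fun z _ => openConn_iff_of_agree_of_forall_not U h hcU hc z
      rw [this]; exact hcard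
  · intro ξ ξ' h
    simp only [mem_setOf_eq, filter_eq_of_agree A U hUA h]
    have e : (∃ x ∈ U, ξ ∈ openConn c x) ↔ (∃ x ∈ U, ξ' ∈ openConn c x) := by
      have := not_iff_not.2 (sep_iff_of_agree U hcU h (ω := ξ) (ω' := ξ'))
      simp only [not_forall, not_not, exists_prop] at this
      exact this
    rw [e]

end SetPort

end Summit.CriticalPhenomena.PercolationContinuityZ3.Theorems

end
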